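import Summits.RiemannHypothesis.RiemannHypothesis.Theorems.WeilFormatCPolyWindowPoleBox
import Literature.NumberTheory.LFunctions.YoshidaWindowGramEntryBox
import HarnessLib

/-!
# Format C, design C∞ — (E) side II-b: kernel enclosures of the prime term `PRIME_{jk}` of the monomial-window entries

Route context: Fourier–Galerkin / Schur-complement certificates of Weil positivity on a window ("format C", design C∞;
`run/shared/lean/pub/rh-explicit/rh-explicit-weil-10/KERNEL-LEVER.md` §17; supporting stmt-RiemannHypothesis-0098; seats
rh-explicit-weil-2 / weil-10).  In `WeilFormatCPolyWindowEntry.weilWindowSesq_indicator_pow` the prime term of `W_a(1x^j, 1x^k)` is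
`PRIME_{jk} = Σ_{log n < 2a} Λ(n) n^{−1/2} K_{jk}(log n)`, `K_{jk}(t) = 2m_{j+k} − O_{jk}(t) − O_{kj}(t)`,
`O_{jk}(t) = Σ_{i≤j} C(j,i) t^{j−i} ((a−t)^{i+k+1} − (−a)^{i+k+1})/(i+k+1)`.  Here, for a RATIONAL window `a` and the prime data
`ks` of the window with its length/weight enclosures (`ConstsValid`: `ℓ_q = log q ∈ C.lens`, `Λ(q)q^{−1/2} ∈ C.wts`), the boxes
`oBox` (the overlap polynomial at an enclosed `t`, evaluated along its printed formula), `kBox` and `primeBox` (the weighted sum)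
are proved to enclose `O_{jk}(t)`, `K_{jk}(t)` and `PRIME_{jk}` (`mem_oBox`, `mem_kBox`, **`mem_primeBox`**); the bridge
`sum_weilPrimeIndex_mul_eq_listSum` turns the `weilPrimeIndex` sum into the list sum over `ks` for ANY weight function of `log n`.
Interval plumbing; standard axioms; no RH claim.
-/

set_option autoImplicit false
-- `Summit.RiemannHypothesis.RiemannHypothesis.…` is the layout-mandated namespace (summit = problem name).
set_option linter.dupNamespace false

open Complex Filter Set MeasureTheory Finset
open scoped Real Topology ArithmeticFunction.vonMangoldt

namespace Summit.RiemannHypothesis.RiemannHypothesis.Theorems.WeilFormatC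

open Literature.NumberTheory.LFunctions Literature.Analysis.SpecialFunctions
open Literature.Analysis.ValidatedNumerics Literature.Analysis.ValidatedNumerics.NumericsMP
open Literature.NumberTheory.LFunctions.Yoshida1992 (PrimeLen PrimeData)
open Literature.NumberTheory.LFunctions.Yoshida1992.Encl (Consts ConstsValid list_sum_map_eq_sum_range)

namespace WinPrime

open WinConst (ratBox mem_ratBox mulRatBox mem_mulRatBox)
open WinPole (momentQ momentQ_cast)

variable {a : ℝ}

/-! ## The `weilPrimeIndex` sum as a list sum over the prime data -/

/-- For any weight `F` of the length: `Σ_{n ∈ weilPrimeIndex a} Λ(n) n^{−1/2} F(log n) = Σ_{q ∈ ks} Λ(q)q^{−1/2} F(ℓ_q)`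
(the von Mangoldt factor kills the non-prime-powers; `PrimeData` lists the prime powers of the window exactly once). -/
theorem sum_weilPrimeIndex_mul_eq_listSum {ks : List PrimeLen} (h : PrimeData a ks) (F : ℝ → ℝ) :
    ∑ n ∈ weilPrimeIndex a, (Λ n : ℝ) / Real.sqrt n * F (Real.log n) = (ks.map fun q ↦ q.wt * F q.len).sum := by
  have step1 : ∑ n ∈ weilPrimeIndex a, (Λ n : ℝ) / Real.sqrt n * F (Real.log n)
      = ∑ n ∈ (weilPrimeIndex a).filter IsPrimePow, (Λ n : ℝ) / Real.sqrt n * F (Real.log n) := by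
    refine (Finset.sum_filter_of_ne fun n _ hne ↦ ?_).symm
    by_contra hn
    rw [ArithmeticFunction.vonMangoldt_eq_zero_iff.mpr hn] at hne
    simp at hne
  have step2 : (weilPrimeIndex a).filter IsPrimePow = (ks.map PrimeLen.val).toFinset := by
    ext n
    simp only [Finset.mem_filter, List.mem_toFinset]
    constructor
    · rintro ⟨hn, hpp⟩; exact (h.mem_iff n hpp).1 hn
    · intro hn
      have hpp : IsPrimePow n := by
        obtain ⟨q, hq, rfl⟩ := List.mem_map.1 hn
        exact PrimeLen.isPrimePow_val (h.prime q hq)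
      exact ⟨(h.mem_iff n hpp).2 hn, hpp⟩
  rw [step1, step2, List.sum_toFinset _ h.nodup, List.map_map]
  congr 1
  refine List.map_congr_left fun q hq ↦ ?_
  simp only [Function.comp_apply]
  rw [PrimeLen.vonMangoldt_div_sqrt_val (h.prime q hq), PrimeLen.log_val]

/-! ## Powers and the overlap polynomial at an enclosed point -/

/-- `X^n` by repeated interval multiplication. -/
def powBox (S : ℕ) (X : MI) : ℕ → MI
  | 0 => MI.ofInt S 1
  | n + 1 => (powBox S X n).mul S X

/-- `powBox ∋ x^n`. -/
theorem mem_powBox {S : ℕ} (hS : 0 < S) {x : ℝ} {X : MI} (hx : MI.mem S x X) :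
    ∀ n : ℕ, MI.mem S (x ^ n) (powBox S X n)
  | 0 => by simpa [powBox] using MI.mem_ofInt S 1
  | n + 1 => by rw [pow_succ, powBox]; exact MI.mem_mul hS (mem_powBox hS hx n) hx

/-- The overlap polynomial `O_{jk}(t) = Σ_{i≤j} C(j,i) t^{j−i} ((a−t)^{i+k+1} − (−a)^{i+k+1})/(i+k+1)` at an enclosed `t`, summed
over `i < n` (use `n = j + 1`). -/
def oBox (S : ℕ) (a : ℚ) (T : MI) (j k : ℕ) : ℕ → MI
  | 0 => MI.ofInt S 0
  | i + 1 => (oBox S a T j k i).add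
      (mulRatBox ((powBox S T (j - i)).mul S ((powBox S ((ratBox S a).sub T) (i + k + 1)).sub
        (ratBox S ((-a) ^ (i + k + 1))))) ((j.choose i : ℚ) / (i + k + 1)))

/-- `oBox … n ∋ Σ_{i<n} C(j,i) t^{j−i} ((a−t)^{i+k+1} − (−a)^{i+k+1})/(i+k+1)`. -/
theorem mem_oBox {S : ℕ} (hS : 0 < S) (a : ℚ) {t : ℝ} {T : MI} (ht : MI.mem S t T) (j k : ℕ) :
    ∀ n : ℕ, MI.mem S (∑ i ∈ Finset.range n, (j.choose i : ℝ) * t ^ (j - i) *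
      ((((a : ℝ) - t) ^ (i + k + 1) - (-(a : ℝ)) ^ (i + k + 1)) / (i + k + 1))) (oBox S a T j k n)
  | 0 => by simpa [oBox] using MI.mem_ofInt S 0
  | i + 1 => by
    rw [Finset.sum_range_succ, oBox]
    refine MI.mem_add (mem_oBox hS a ht j k i) ?_
    have hat : MI.mem S ((a : ℝ) - t) ((ratBox S a).sub T) := MI.mem_sub (mem_ratBox S a) ht
    have hpw := MI.mem_sub (mem_powBox hS hat (i + k + 1)) (mem_ratBox S ((-a) ^ (i + k + 1)))
    have hprod := MI.mem_mul hS (mem_powBox hS ht (j - i)) hpw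
    have h := mem_mulRatBox hprod ((j.choose i : ℚ) / (i + k + 1))
    convert h using 1
    push_cast
    ring

/-- `K_{jk}(t) = 2m_{j+k} − O_{jk}(t) − O_{kj}(t)` at an enclosed `t`. -/
def kBox (S : ℕ) (a : ℚ) (T : MI) (j k : ℕ) : MI :=
  ((ratBox S (2 * momentQ a (j + k))).sub (oBox S a T j k (j + 1))).sub (oBox S a T k j (k + 1))

/-- `kBox ∋ K_{jk}(t)` (with the two overlap polynomials written exactly as in `weilWindowSesq_indicator_pow`). -/
theorem mem_kBox {S : ℕ} (hS : 0 < S) (a : ℚ) {t : ℝ} {T : MI} (ht : MI.mem S t T) (j k : ℕ) :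
    MI.mem S (2 * (((a : ℝ) ^ (j + k + 1) - (-(a : ℝ)) ^ (j + k + 1)) / (j + k + 1))
        - (∑ i ∈ Finset.range (j + 1), (j.choose i : ℝ) * t ^ (j - i) *
            ((((a : ℝ) - t) ^ (i + k + 1) - (-(a : ℝ)) ^ (i + k + 1)) / (i + k + 1)))
        - (∑ i ∈ Finset.range (k + 1), (k.choose i : ℝ) * t ^ (k - i) *
            ((((a : ℝ) - t) ^ (i + j + 1) - (-(a : ℝ)) ^ (i + j + 1)) / (i + j + 1)))) (kBox S a T j k) := by
  have hm : MI.mem S (2 * (((a : ℝ) ^ (j + k + 1) - (-(a : ℝ)) ^ (j + k + 1)) / (j + k + 1)))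
      (ratBox S (2 * momentQ a (j + k))) := by
    have := mem_ratBox S (2 * momentQ a (j + k))
    convert this using 1
    push_cast
    rw [momentQ_cast]
    push_cast
    ring
  exact MI.mem_sub (MI.mem_sub hm (mem_oBox hS a ht j k (j + 1))) (mem_oBox hS a ht k j (k + 1))

/-! ## The weighted prime sum -/

/-- `Σ_{i<n} wts_i · K_{jk}(lens_i)`. -/
def primeBox (S : ℕ) (a : ℚ) (lens wts : List MI) (j k : ℕ) : ℕ → MI
  | 0 => MI.ofInt S 0
  | i + 1 => (primeBox S a lens wts j k i).add ((wts.getD i default).mul S (kBox S a (lens.getD i default) j k))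

/-- The summand of `PRIME_{jk}` as a function of the length `t = log n`. -/
private noncomputable def kFun (a : ℝ) (j k : ℕ) (t : ℝ) : ℝ :=
  2 * ((a ^ (j + k + 1) - (-a) ^ (j + k + 1)) / (j + k + 1))
    - (∑ i ∈ Finset.range (j + 1), (j.choose i : ℝ) * t ^ (j - i) *
        (((a - t) ^ (i + k + 1) - (-a) ^ (i + k + 1)) / (i + k + 1)))
    - (∑ i ∈ Finset.range (k + 1), (k.choose i : ℝ) * t ^ (k - i) *
        (((a - t) ^ (i + j + 1) - (-a) ^ (i + j + 1)) / (i + j + 1)))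

/-- `primeBox … n ∋ Σ_{i<n} Λ(q_i)q_i^{−1/2} K_{jk}(ℓ_{q_i})` along the prime data. -/
theorem mem_primeBox_range {S : ℕ} (hS : 0 < S) {a : ℚ} {ks : List PrimeLen} {C : Consts}
    (hC : ConstsValid S (a : ℝ) ks C) (j k : ℕ) :
    ∀ n, n ≤ ks.length → MI.mem S (∑ i ∈ Finset.range n,
      (ks.getD i default).wt * kFun (a : ℝ) j k (ks.getD i default).len) (primeBox S a C.lens C.wts j k n)
  | 0, _ => by simpa [primeBox] using MI.mem_ofInt S 0
  | n + 1, hn => by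
    rw [Finset.sum_range_succ, primeBox]
    have hn' : n < ks.length := hn
    exact MI.mem_add (mem_primeBox_range hS hC j k n (by omega))
      (MI.mem_mul hS (hC.wts n hn') (mem_kBox hS a (hC.lens n hn') j k))

/-- **`primeBox ∋ PRIME_{jk}`**: for a rational window `a`, its prime data `ks` and validated constants `C`,
`Σ_{n ∈ weilPrimeIndex a} Λ(n)n^{−1/2} K_{jk}(log n) ∈ primeBox S a C.lens C.wts j k ks.length`. -/
theorem mem_primeBox {S : ℕ} (hS : 0 < S) {a : ℚ} {ks : List PrimeLen} (hks : PrimeData (a : ℝ) ks) {C : Consts}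
    (hC : ConstsValid S (a : ℝ) ks C) (j k : ℕ) :
    MI.mem S (∑ n ∈ weilPrimeIndex (a : ℝ), (Λ n : ℝ) / Real.sqrt n *
        (2 * (((a : ℝ) ^ (j + k + 1) - (-(a : ℝ)) ^ (j + k + 1)) / (j + k + 1))
          - (∑ i ∈ Finset.range (j + 1), (j.choose i : ℝ) * Real.log n ^ (j - i) *
              ((((a : ℝ) - Real.log n) ^ (i + k + 1) - (-(a : ℝ)) ^ (i + k + 1)) / (i + k + 1)))
          - (∑ i ∈ Finset.range (k + 1), (k.choose i : ℝ) * Real.log n ^ (k - i) *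
              ((((a : ℝ) - Real.log n) ^ (i + j + 1) - (-(a : ℝ)) ^ (i + j + 1)) / (i + j + 1)))))
      (primeBox S a C.lens C.wts j k ks.length) := by
  have h := sum_weilPrimeIndex_mul_eq_listSum hks (kFun (a : ℝ) j k)
  simp only [kFun] at h
  rw [h, list_sum_map_eq_sum_range]
  exact mem_primeBox_range hS hC j k ks.length le_rfl

end WinPrime

end Summit.RiemannHypothesis.RiemannHypothesis.Theorems.WeilFormatC
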